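import Literature.NumberTheory.Irrationality.Zudilin2014.SecondTalePadicBlocks

/-!
# Zudilin 2014, second tale: eq. (T3a) for `A_k`, `B_k` and Lemma 8 (general parameters)

Topic `Literature/NumberTheory/Irrationality/Zudilin2014` [Zudilin2014ZetaTwo, Section 6, eq. (T3a) and Lemma 8].
PROVED here, for admissible parameters (eq. (cond2), `AdmissibleT a b`) with `b̂₀, b̂₁ ≥ 0` and every prime `p` with
`2 b̂₃* ≤ p²` (one Legendre digit per factorial, one `p` per cover-up reciprocal; at the parameters (T-gen) this is
every prime `p ≥ c√n`):

* **eq. (T3a)** [cite: Zudilin2014ZetaTwo, Section 6, eq. (T3a)]: with `digitT p a b k` the printed right-hand side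
  (integer floors, `SecondTalePadicBlocks.digitT_eq`),
  `‖A_k‖_p ≤ p^{−digitT}` at the double poles (`padicNorm_coefAT_le`) and `‖B_k‖_p ≤ p^{1−digitT}` at every pole of
  `R̂` (`padicNorm_coefBT_le`), i.e. `ord_p A_k, 1 + ord_p B_k ≥ digitT`.  The proof is the one the paper points to
  ("follow from [Zu04]", [Zudilin2004OddZeta, Lemmas 1–4]) run on the tree's cover-up definitions: at a double pole
  `B_k = (f₂/E₂)(f₃/E₃)·[P₀′P₁ + P₀P₁′ − P₀P₁(Σ₂+Σ₃)]` (`coefBT_double_eq`; `P` = numerator blocks over their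
  factorials, `f_j/E_j` = pole blocks over their cover-up products, `Σ_j` = cover-up sums), at a simple pole
  `B_k = (f₂/E₂)(f₃/E₃)P₀P₁` with one pole block off its block (`numT_div_dhatT_eq`), and each factor is estimated by
  `SecondTalePadicBlocks`;
* **Lemma 8 for general parameters** [cite: Zudilin2014ZetaTwo, Lemma 8]: if `e ≤ digitT p a b k` for every `k` of
  the `A`-range `[â₃*, b̂₂*)`, then `‖q̂(â,b̂)‖_p ≤ p^{−e}` (`padicNorm_formQT_le`); if `e ≤ digitT p a b k` for every
  `k` of the `B`-range `[â₂*, b̂₃*)` (which contains the `A`-range), then `‖p̂(â,b̂)‖_p ≤ p^{2−e}`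
  (`padicNorm_formPT_le`; `‖Σ_{ℓ≤m}(−1)^{ℓ−1}/ℓ^s‖_p ≤ p^s`).  Specialised to (T-gen) and minimised over `y = (k−1)/p`
  these are the printed `ord_p q̂ ≥ φ̂(n/p)`, `ord_p p̂ ≥ −2 + φ̂(n/p)` for the primes with `2b̂₃* ≤ p²`; the tree's P15
  partner files (`TwoTaleP15SecondTaleB*`) prove the sharper partner-specific versions directly.

Cell pub-zeta5 (HONEST FRAMING: systematic search; no irrationality claim unless certified).
-/

noncomputable section

open Polynomial Finset

namespace Literature.NumberTheory.Irrationality.Zudilin2014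

section Padic

variable {p : ℕ} [hp : Fact p.Prime]

/-! ### Norm bookkeeping (private copies of the helpers of `SecondTalePadicBlocks`) -/

/-- `facZ m ≠ 0`. [cite: Zudilin2014ZetaTwo, Section 3, eq. (gc)] -/
private theorem facZ_ne_zero (m : ℤ) : facZ m ≠ 0 := by
  rw [facZ_eq]; exact_mod_cast Nat.factorial_ne_zero _

/-- `(p : ℚ) ≠ 0`. [cite: Zudilin2014ZetaTwo, Section 6, eq. (T3a)] -/
private theorem castp_ne_zero : (p : ℚ) ≠ 0 := by exact_mod_cast hp.out.ne_zero

/-- `1 ≤ (p : ℚ)`. [cite: Zudilin2014ZetaTwo, Section 6, eq. (T3a)] -/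
private theorem one_le_castp : (1 : ℚ) ≤ p := by exact_mod_cast hp.out.one_lt.le

omit hp in
/-- `‖(−1)^n‖_p = 1`. [cite: Zudilin2014ZetaTwo, Section 6, eq. (T2) (signs)] -/
private theorem padicNorm_neg_one_pow (n : ℕ) : padicNorm p ((-1 : ℚ) ^ n) = 1 := by
  rcases neg_one_pow_eq_or ℚ n with h | h <;> rw [h] <;> simp

/-- Norm bookkeeping: products add exponents. [cite: Zudilin2014ZetaTwo, Section 6, eq. (T3a)] -/
private theorem norm_mul_le {x y : ℚ} {e f : ℤ} (hx : padicNorm p x ≤ (p : ℚ) ^ e) (hy : padicNorm p y ≤ (p : ℚ) ^ f) :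
    padicNorm p (x * y) ≤ (p : ℚ) ^ (e + f) := by
  rw [padicNorm.mul, zpow_add₀ castp_ne_zero]
  exact mul_le_mul hx hy (padicNorm.nonneg _) (zpow_nonneg (by positivity) _)

/-- Norm bookkeeping: the ultrametric inequality. [cite: Zudilin2014ZetaTwo, Section 6, eq. (T3a)] -/
private theorem norm_add_le {x y : ℚ} {e : ℤ} (hx : padicNorm p x ≤ (p : ℚ) ^ e) (hy : padicNorm p y ≤ (p : ℚ) ^ e) :
    padicNorm p (x + y) ≤ (p : ℚ) ^ e :=
  (padicNorm.nonarchimedean (p := p)).trans (max_le hx hy)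

/-- Norm bookkeeping: the ultrametric inequality for a difference. [cite: Zudilin2014ZetaTwo, Section 6, eq. (T3a)] -/
private theorem norm_sub_le {x y : ℚ} {e : ℤ} (hx : padicNorm p x ≤ (p : ℚ) ^ e) (hy : padicNorm p y ≤ (p : ℚ) ^ e) :
    padicNorm p (x - y) ≤ (p : ℚ) ^ e := by
  rw [sub_eq_add_neg]; exact norm_add_le hx (by rwa [padicNorm.neg])

/-! ### The factorised forms of `A_k` and `B_k` -/

omit hp in
/-- `numT(−k)/dhatT(−k) = (f₂/E₂)·(f₃/E₃)·(block2(−k)/(â₀−b̂₀)!)·(block(−k)/(â₁−b̂₁)!)` (pole blocks over cover-up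
products, numerator blocks over their factorials). [cite: Zudilin2014ZetaTwo, Section 6, eq. (T2)] -/
theorem numT_div_dhatT_eq (a b : Fin 4 → ℤ) (k : ℤ) :
    (numT a b).eval (-(k : ℚ)) / (dhatT a b k).eval (-(k : ℚ))
      = facZ (b 2 - a 2 - 1) / coverProd (a 2) (b 2) k * (facZ (b 3 - a 3 - 1) / coverProd (a 3) (b 3) k)
        * ((block2 (b 0) (a 0)).eval (-(k : ℚ)) / facZ (a 0 - b 0))
        * ((block (b 1) (a 1)).eval (-(k : ℚ)) / facZ (a 1 - b 1)) := by
  have hE2 := coverProd_ne_zero (a 2) (b 2) k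
  have hE3 := coverProd_ne_zero (a 3) (b 3) k
  have hf0 := facZ_ne_zero (a 0 - b 0)
  have hf1 := facZ_ne_zero (a 1 - b 1)
  unfold numT normT
  rw [eval_mul, eval_C, eval_mul, eval_dhatT_eq_coverProd]
  field_simp

omit hp in
/-- **`B_k` at a double pole, factorised**: `B_k = (numT′(−k) − numT(−k)(Σ₂+Σ₃))/dhatT(−k)`
`= (f₂/E₂)(f₃/E₃)·[P₀′P₁ + P₀P₁′ − P₀P₁(Σ₂+Σ₃)]` (quotient rule, `dhatT′(−k) = dhatT(−k)(Σ₂+Σ₃)`).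
[cite: Zudilin2014ZetaTwo, Section 6, eq. (T3a)] [cite: Zudilin2004OddZeta, proof of Lemma 4] -/
theorem coefBT_double_eq {a b : Fin 4 → ℤ} {k : ℤ} (h2 : k ∈ Ico (a 2) (b 2)) (h3 : k ∈ Ico (a 3) (b 3)) :
    coefBT a b k
      = facZ (b 2 - a 2 - 1) / coverProd (a 2) (b 2) k * (facZ (b 3 - a 3 - 1) / coverProd (a 3) (b 3) k)
        * ((derivative (block2 (b 0) (a 0))).eval (-(k : ℚ)) / facZ (a 0 - b 0)
            * ((block (b 1) (a 1)).eval (-(k : ℚ)) / facZ (a 1 - b 1))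
          + (block2 (b 0) (a 0)).eval (-(k : ℚ)) / facZ (a 0 - b 0)
            * ((derivative (block (b 1) (a 1))).eval (-(k : ℚ)) / facZ (a 1 - b 1))
          - (block2 (b 0) (a 0)).eval (-(k : ℚ)) / facZ (a 0 - b 0)
            * ((block (b 1) (a 1)).eval (-(k : ℚ)) / facZ (a 1 - b 1))
            * (∑ i ∈ (Ico (a 2) (b 2)).erase k, 1 / ((i : ℚ) - k)
              + ∑ i ∈ (Ico (a 3) (b 3)).erase k, 1 / ((i : ℚ) - k))) := by
  have hE2 := coverProd_ne_zero (a 2) (b 2) k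
  have hE3 := coverProd_ne_zero (a 3) (b 3) k
  have hf0 := facZ_ne_zero (a 0 - b 0)
  have hf1 := facZ_ne_zero (a 1 - b 1)
  unfold coefBT
  rw [qpolyT_eq_of_double h2 h3, eval_derivative_dhatT_eq, eval_dhatT_eq_coverProd]
  unfold numT normT
  rw [derivative_C_mul, derivative_mul]
  simp only [eval_mul, eval_C, eval_add]
  field_simp

/-! ### Eq. (T3a) -/

/-- **Zudilin 2014, eq. (T3a) for `A_k`** [cite: Zudilin2014ZetaTwo, Section 6, eq. (T3a)]: at a double pole,
`‖A_k‖_p ≤ p^{−digitT}`, i.e. `ord_p A_k ≥` the right-hand side of (T3a) (admissible parameters with `b̂₀, b̂₁ ≥ 0`,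
primes with `2b̂₃* ≤ p²`). -/
theorem padicNorm_coefAT_le {a b : Fin 4 → ℤ} (hab : AdmissibleT a b) (hb0 : 0 ≤ b 0) (hb1 : 0 ≤ b 1)
    (hp2 : 2 * bMax b ≤ (p : ℤ) ^ 2) {k : ℤ} (h2 : k ∈ Ico (a 2) (b 2)) (h3 : k ∈ Ico (a 3) (b 3)) :
    padicNorm p (coefAT a b k) ≤ (p : ℚ) ^ (-digitT p a b k) := by
  have hk2 := mem_Ico.1 h2
  have hk3 := mem_Ico.1 h3
  have hbM2 : b 2 ≤ bMax b := le_max_left _ _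
  have hbM3 : b 3 ≤ bMax b := le_max_right _ _
  have hb0a := hab.b0_le 2 (by decide)
  have hb1a := hab.b1_le 2 (by decide)
  have hb1a' := hab.b1_le 3 (by decide)
  have ha0 := hab.a0_lt
  have ha1 := hab.a_lt 1 (by decide)
  have hV2 := (padicNorm_facZ_div_coverProd_of_mem (p := p) h2 (by omega)).le
  have hV3 := (padicNorm_facZ_div_coverProd_of_mem (p := p) h3 (by omega)).le
  have hP0 := padicNorm_eval_block2_div_facZ (p := p) hab.b0_le_a0 (k := k) (by omega) (by omega)
  have hP1 := padicNorm_eval_block_div_facZ (p := p) (hab.b1_le 1 (by decide)) (k := k) (by omega) (by omega)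
  unfold coefAT
  rw [qpolyT_eq_of_double h2 h3, numT_div_dhatT_eq]
  exact (norm_mul_le (norm_mul_le (norm_mul_le hV2 hV3) hP0) hP1).trans
    (le_of_eq (congrArg (fun t : ℤ => (p : ℚ) ^ t) (by unfold digitT; ring)))

/-- **Zudilin 2014, eq. (T3a) for `B_k`** [cite: Zudilin2014ZetaTwo, Section 6, eq. (T3a)]: at every pole `−k` of `R̂`
(`k ∈ [â₂,b̂₂) ∪ [â₃,b̂₃)`, stated as in `exists_int_lcm_mul_coefBT`), `‖B_k‖_p ≤ p^{1−digitT}`, i.e. `1 + ord_p B_k ≥` the right-hand side of (T3a)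
(admissible parameters with `b̂₀, b̂₁ ≥ 0`, primes with `2b̂₃* ≤ p²`).  [cite: Zudilin2004OddZeta, Lemmas 1–4] -/
theorem padicNorm_coefBT_le {a b : Fin 4 → ℤ} (hab : AdmissibleT a b) (hb0 : 0 ≤ b 0) (hb1 : 0 ≤ b 1)
    (hp2 : 2 * bMax b ≤ (p : ℤ) ^ 2) {k : ℤ} (hk : k ∈ Ico (a 2) (b 2) ∨ k ∈ Ico (a 3) (b 3)) :
    padicNorm p (coefBT a b k) ≤ (p : ℚ) ^ (1 - digitT p a b k) := by
  have hbM2 : b 2 ≤ bMax b := le_max_left _ _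
  have hbM3 : b 3 ≤ bMax b := le_max_right _ _
  have hb02 := hab.b0_le 2 (by decide)
  have hb03 := hab.b0_le 3 (by decide)
  have hb12 := hab.b1_le 2 (by decide)
  have hb13 := hab.b1_le 3 (by decide)
  have ha0 := hab.a0_lt
  have ha1 := hab.a_lt 1 (by decide)
  have ha2 := hab.a_lt 2 (by decide)
  have ha3 := hab.a_lt 3 (by decide)
  have hkr : min (a 2) (a 3) ≤ k ∧ k < bMax b := by
    rcases hk with h | h <;> have := mem_Ico.1 h <;> constructor <;> omega
  have hP0 := padicNorm_eval_block2_div_facZ (p := p) hab.b0_le_a0 (k := k) (by omega) (by omega)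
  have hP0' := padicNorm_eval_derivative_block2_div_facZ (p := p) hab.b0_le_a0 (k := k) (by omega) (by omega)
    (by omega)
  have hP1 := padicNorm_eval_block_div_facZ (p := p) (hab.b1_le 1 (by decide)) (k := k) (by omega) (by omega)
  have hP1' := padicNorm_eval_derivative_block_div_facZ (p := p) (hab.b1_le 1 (by decide)) (k := k) (by omega)
    (by omega) (by omega)
  by_cases h2m : k ∈ Ico (a 2) (b 2) <;> by_cases h3m : k ∈ Ico (a 3) (b 3)
  · -- double pole
    have hk2 := mem_Ico.1 h2m
    have hk3 := mem_Ico.1 h3m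
    have hV2 := (padicNorm_facZ_div_coverProd_of_mem (p := p) h2m (by omega)).le
    have hV3 := (padicNorm_facZ_div_coverProd_of_mem (p := p) h3m (by omega)).le
    have h1 : padicNorm p (1 : ℚ) ≤ 1 := by simp
    have hS : padicNorm p (∑ i ∈ (Ico (a 2) (b 2)).erase k, 1 / ((i : ℚ) - k)
        + ∑ i ∈ (Ico (a 3) (b 3)).erase k, 1 / ((i : ℚ) - k)) ≤ (p : ℚ) ^ (1 : ℤ) := by
      rw [zpow_one]
      refine (padicNorm.nonarchimedean (p := p)).trans (max_le ?_ ?_) <;>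
        refine padicNorm_sum_div_sub_le _ _ h1 fun i hi => ?_ <;>
        · have hik := mem_erase.1 hi
          have hi' := mem_Ico.1 hik.2
          exact ⟨hik.1, by rw [abs_lt]; constructor <;> omega⟩
    have t1 := (norm_mul_le hP0' hP1).trans (le_of_eq (congrArg (fun t : ℤ => (p : ℚ) ^ t) (by ring :
      (1 : ℤ) - fdig p (2 * k - b 0) (a 0 - b 0) + -fdig p (k - b 1) (a 1 - b 1)
        = 1 - fdig p (2 * k - b 0) (a 0 - b 0) - fdig p (k - b 1) (a 1 - b 1))))
    have t2 := (norm_mul_le hP0 hP1').trans (le_of_eq (congrArg (fun t : ℤ => (p : ℚ) ^ t) (by ring :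
      -fdig p (2 * k - b 0) (a 0 - b 0) + ((1 : ℤ) - fdig p (k - b 1) (a 1 - b 1))
        = 1 - fdig p (2 * k - b 0) (a 0 - b 0) - fdig p (k - b 1) (a 1 - b 1))))
    have t3 := (norm_mul_le (norm_mul_le hP0 hP1) hS).trans (le_of_eq (congrArg (fun t : ℤ => (p : ℚ) ^ t) (by ring :
      -fdig p (2 * k - b 0) (a 0 - b 0) + -fdig p (k - b 1) (a 1 - b 1) + (1 : ℤ)
        = 1 - fdig p (2 * k - b 0) (a 0 - b 0) - fdig p (k - b 1) (a 1 - b 1))))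
    rw [coefBT_double_eq h2m h3m]
    exact (norm_mul_le (norm_mul_le hV2 hV3) (norm_sub_le (norm_add_le t1 t2) t3)).trans
      (le_of_eq (congrArg (fun t : ℤ => (p : ℚ) ^ t) (by unfold digitT; ring)))
  · -- simple pole in `[â₂, b̂₂)`, off the block `[â₃, b̂₃)`
    have hk2 := mem_Ico.1 h2m
    have hm : multT a b k = 1 := by unfold multT; rw [if_pos h2m, if_neg h3m]
    have hV2 := (padicNorm_facZ_div_coverProd_of_mem (p := p) h2m (by omega)).le
    have hV3 := (padicNorm_facZ_div_coverProd_of_not_mem (p := p) (lo := a 3) (hi := b 3) (k := k) (by omega) h3m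
      (by omega) (by omega)).le
    rw [coefBT_of_simple hm, numT_div_dhatT_eq]
    exact (norm_mul_le (norm_mul_le (norm_mul_le hV2 hV3) hP0) hP1).trans
      (le_of_eq (congrArg (fun t : ℤ => (p : ℚ) ^ t) (by unfold digitT; ring)))
  · -- simple pole in `[â₃, b̂₃)`, off the block `[â₂, b̂₂)`
    have hk3 := mem_Ico.1 h3m
    have hm : multT a b k = 1 := by unfold multT; rw [if_neg h2m, if_pos h3m]
    have hV2 := (padicNorm_facZ_div_coverProd_of_not_mem (p := p) (lo := a 2) (hi := b 2) (k := k) (by omega) h2m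
      (by omega) (by omega)).le
    have hV3 := (padicNorm_facZ_div_coverProd_of_mem (p := p) h3m (by omega)).le
    rw [coefBT_of_simple hm, numT_div_dhatT_eq]
    exact (norm_mul_le (norm_mul_le (norm_mul_le hV2 hV3) hP0) hP1).trans
      (le_of_eq (congrArg (fun t : ℤ => (p : ℚ) ^ t) (by unfold digitT; ring)))
  · exact absurd hk (by tauto)

/-! ### Lemma 8 -/

/-- `‖Σ_{ℓ≤m} (−1)^{ℓ−1}/ℓ²‖_p ≤ p²` for `m < p²`. [cite: Zudilin2014ZetaTwo, proof of Lemma 8] -/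
private theorem padicNorm_harmAlt2_le {m : ℕ} (hm : (m : ℤ) < (p : ℤ) ^ 2) :
    padicNorm p (harmAlt2 m) ≤ (p : ℚ) ^ (2 : ℤ) := by
  unfold harmAlt2
  refine padicNorm.sum_le' (fun l hl => ?_) (by positivity)
  have hl' := mem_range.1 hl
  have hne : ((l : ℤ) + 1) ≠ 0 := by omega
  have h1 : padicNorm p (((l : ℚ) + 1)⁻¹) ≤ p := by
    have := padicNorm_inv_intCast_le_of_abs_lt_sq (p := p) hne (by rw [abs_of_nonneg (by omega)]; omega)
    push_cast at this
    exact this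
  have hs : padicNorm p ((-1 : ℚ) ^ l) ≤ 1 := (padicNorm_neg_one_pow l).le
  rw [div_eq_mul_inv, ← inv_pow, sq, ← mul_assoc, padicNorm.mul, padicNorm.mul, zpow_two]
  exact mul_le_mul (mul_le_mul hs h1 (padicNorm.nonneg _) zero_le_one |>.trans_eq (one_mul _)) h1
    (padicNorm.nonneg _) (by positivity)

/-- `‖Σ_{ℓ≤m} (−1)^{ℓ−1}/ℓ‖_p ≤ p` for `m < p²`. [cite: Zudilin2014ZetaTwo, proof of Lemma 8] -/
private theorem padicNorm_harmAlt1_le {m : ℕ} (hm : (m : ℤ) < (p : ℤ) ^ 2) :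
    padicNorm p (harmAlt1 m) ≤ (p : ℚ) ^ (1 : ℤ) := by
  unfold harmAlt1
  refine padicNorm.sum_le' (fun l hl => ?_) (by positivity)
  have hl' := mem_range.1 hl
  have hne : ((l : ℤ) + 1) ≠ 0 := by omega
  have h1 : padicNorm p (((l : ℚ) + 1)⁻¹) ≤ p := by
    have := padicNorm_inv_intCast_le_of_abs_lt_sq (p := p) hne (by rw [abs_of_nonneg (by omega)]; omega)
    push_cast at this
    exact this
  have hs : padicNorm p ((-1 : ℚ) ^ l) ≤ 1 := (padicNorm_neg_one_pow l).le
  rw [div_eq_mul_inv, padicNorm.mul, zpow_one]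
  exact (mul_le_mul hs h1 (padicNorm.nonneg _) zero_le_one).trans_eq (one_mul _)

/-- **Zudilin 2014, Lemma 8 — the `q̂`-half, for general admissible parameters** [cite: Zudilin2014ZetaTwo, Lemma 8]:
if `e ≤ digitT p a b k` for every `k` of the `A`-range `[â₃*, b̂₂*)`, then `‖q̂(â,b̂)‖_p ≤ p^{−e}`, i.e. `ord_p q̂(â,b̂) ≥ e`
(from (T3a) for `A_k` and `q̂ = (−1)^{d̂} Σ A_k`, eq. (T5)); primes with `2b̂₃* ≤ p²`. -/
theorem padicNorm_formQT_le {a b : Fin 4 → ℤ} (hab : AdmissibleT a b) (hb0 : 0 ≤ b 0) (hb1 : 0 ≤ b 1)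
    (hp2 : 2 * bMax b ≤ (p : ℤ) ^ 2) {e : ℤ} (he : ∀ k ∈ Ico (aMax3 a) (bMin b), e ≤ digitT p a b k) :
    padicNorm p (formQT a b) ≤ (p : ℚ) ^ (-e) := by
  have hp1 := one_le_castp (p := p)
  unfold formQT signT
  rw [padicNorm.mul, padicNorm_neg_one_pow, one_mul]
  refine padicNorm.sum_le' (fun k hk => ?_) (by positivity)
  obtain ⟨h2, h3, -⟩ := mem_double_of_mem_range hk
  exact (padicNorm_coefAT_le hab hb0 hb1 hp2 h2 h3).trans (zpow_le_zpow_right₀ hp1 (by have := he k hk; omega))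

/-- **Zudilin 2014, Lemma 8 — the `p̂`-half, for general admissible parameters** [cite: Zudilin2014ZetaTwo, Lemma 8]:
if `e ≤ digitT p a b k` for every `k` in the `B`-range `[â₂*, b̂₃*)` (which contains the `A`-range `[â₃*, b̂₂*)`),
then `‖p̂(â,b̂)‖_p ≤ p^{2−e}`, i.e. `ord_p p̂(â,b̂) ≥ −2 + e` — from (T3a) and the explicit expression of `p̂` in the
proof of Proposition 3 (`formPT`), one prime `p` with `2b̂₃* ≤ p²` at a time. -/
theorem padicNorm_formPT_le {a b : Fin 4 → ℤ} (hab : AdmissibleT a b) (hb0 : 0 ≤ b 0) (hb1 : 0 ≤ b 1)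
    (hp2 : 2 * bMax b ≤ (p : ℤ) ^ 2) {e : ℤ} (he : ∀ k ∈ Ico (aMid a) (bMax b), e ≤ digitT p a b k) :
    padicNorm p (formPT a b) ≤ (p : ℚ) ^ (2 - e) := by
  have hp1 := one_le_castp (p := p)
  have hb11 := hab.b1_le 1 (by decide)
  have hb12 := hab.b1_le 2 (by decide)
  have hb13 := hab.b1_le 3 (by decide)
  have hb01 := hab.b0_le 1 (by decide)
  have hb02 := hab.b0_le 2 (by decide)
  have hb03 := hab.b0_le 3 (by decide)
  have hba := hab.b0_le_a0
  have hmid : b 1 ≤ aMid a ∧ aMid a ≤ aMax3 a ∧ bMin b ≤ bMax b ∧ 0 ≤ a0star a := by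
    simp only [aMid, aMax3, bMin, bMax, a0star]; omega
  unfold formPT signT
  rw [padicNorm.mul, padicNorm_neg_one_pow, one_mul]
  refine norm_add_le (padicNorm.sum_le' (fun k hk => ?_) (by positivity))
    (padicNorm.sum_le' (fun k hk => ?_) (by positivity))
  · -- the `A`-terms `2 A_k Σ (−1)^{ℓ−1}/ℓ²`
    obtain ⟨h2, h3, -⟩ := mem_double_of_mem_range hk
    have hk' := mem_Ico.1 hk
    have hkB : k ∈ Ico (aMid a) (bMax b) := mem_Ico.2 ⟨by omega, by omega⟩
    have hA := padicNorm_coefAT_le hab hb0 hb1 hp2 h2 h3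
    have hH := padicNorm_harmAlt2_le (p := p) (m := (2 * k - a0star a).toNat) (by omega)
    have htwo : padicNorm p (2 : ℚ) ≤ (p : ℚ) ^ (0 : ℤ) := by
      rw [zpow_zero]; exact_mod_cast padicNorm.of_int (p := p) 2
    exact (norm_mul_le (norm_mul_le htwo hA) hH).trans (zpow_le_zpow_right₀ hp1 (by have := he k hkB; omega))
  · -- the `B`-terms `B_k Σ (−1)^{ℓ−1}/ℓ`
    have hk' := mem_Ico.1 hk
    have hB := padicNorm_coefBT_le hab hb0 hb1 hp2 (mem_pole_of_mem_rangeB hab hk)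
    have hH := padicNorm_harmAlt1_le (p := p) (m := (2 * k - a0star a).toNat) (by omega)
    exact (norm_mul_le hB hH).trans (zpow_le_zpow_right₀ hp1 (by have := he k hk; omega))

end Padic

end Literature.NumberTheory.Irrationality.Zudilin2014

end
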